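import Mathlib
import Summits.Ventures.HodgeRepro2.T5SchurOrthogonality

/-!
# T5SchurFinite — the printed finite-group case of the Schur orthogonality relations

Tier-5 support (seat p1, cell pub-hodge-repro2), companion of `T5SchurOrthogonality.lean`
(p394792). Goodman–Wallach, *Symmetry, Representations, and Invariants* (GTM 255), Lemma 4.3.3
(p. 208) is stated for a FINITE group with the average `(1/|G|) Σ_{g ∈ G}`; the compact-group
version is the remark of §7.3.4 (p. 360). The accepted file proves the compact-group version for
any left-invariant probability measure; this file specialises it back to the printed finite case:
a finite group `G` (discrete topology, Borel σ-algebra) with the uniform probability measure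
`ProbabilityTheory.uniformOn Set.univ = |G|⁻¹ • count`, so that the integral IS the printed
average `(1/|G|) Σ_g`. No continuity hypothesis remains (every map on a discrete group is
continuous).

* `uniformOn_univ_eq_smul_count`, `isMulLeftInvariant_uniformOn_univ`: the uniform measure is
  `|G|⁻¹ • count` and left-invariant;
* `integral_uniformOn_univ`: `∫ f d(uniformOn univ) = |G|⁻¹ • Σ_g f g`;
* `schur_orthogonality_finite`: `|G|⁻¹ Σ_g ⟪v, π g u⟫ · conj ⟪y, π g x⟫ = (dim V)⁻¹ ⟪x, u⟫ ⟪v, y⟫`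
  (the printed (4.33) in matrix-coefficient form, `μ = λ*` case);
* `sum_character_mul_conj_finite`: `|G|⁻¹ Σ_g |χ_π(g)|² = 1`;
* `sum_inner_mul_conj_eq_zero_finite`: the «otherwise 0» case for `π`, `σ` without a non-zero
  intertwiner.

Honest scope: nothing about (N) or any specific group.
-/

noncomputable section

open MeasureTheory ComplexConjugate ProbabilityTheory
open scoped InnerProductSpace ENNReal

namespace Summit.Ventures.HodgeRepro2.T5SchurFinite

open Summit.Ventures.HodgeRepro2.T5SchurOrthogonality

variable {G : Type*} [Group G] [Fintype G] [MeasurableSpace G] [MeasurableSingletonClass G]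

omit [Group G] [MeasurableSingletonClass G] in
/-- The uniform probability measure on a finite type is `|G|⁻¹ • count`. -/
theorem uniformOn_univ_eq_smul_count :
    uniformOn (Set.univ : Set G) = ((Fintype.card G : ℝ≥0∞)⁻¹) • (Measure.count : Measure G) := by
  rw [uniformOn, ProbabilityTheory.cond, Measure.restrict_univ, Measure.count_univ]
  simp

/-- The uniform measure on a finite group is left-invariant. -/
instance isMulLeftInvariant_uniformOn_univ [MeasurableMul G] :
    (uniformOn (Set.univ : Set G)).IsMulLeftInvariant := by
  rw [uniformOn_univ_eq_smul_count]
  infer_instance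

omit [Group G] in
/-- The integral against the uniform measure is the average `|G|⁻¹ • Σ_g f g`. -/
theorem integral_uniformOn_univ {E : Type*} [NormedAddCommGroup E] [NormedSpace ℝ E]
    [CompleteSpace E] (f : G → E) :
    ∫ g, f g ∂(uniformOn (Set.univ : Set G)) = (Fintype.card G : ℝ)⁻¹ • ∑ g, f g := by
  rw [uniformOn_univ_eq_smul_count, integral_smul_measure, integral_count]
  simp

omit [Group G] in
/-- The integral of a complex function against the uniform measure, as a complex average. -/
theorem integral_uniformOn_univ_complex (f : G → ℂ) :
    ∫ g, f g ∂(uniformOn (Set.univ : Set G)) = (Fintype.card G : ℂ)⁻¹ * ∑ g, f g := by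
  rw [integral_uniformOn_univ]
  simp [Complex.real_smul]

variable {V W : Type*} [NormedAddCommGroup V] [InnerProductSpace ℂ V] [FiniteDimensional ℂ V]
  [NormedAddCommGroup W] [InnerProductSpace ℂ W]
variable [TopologicalSpace G] [DiscreteTopology G] [BorelSpace G]
variable (π : G →* (V →L[ℂ] V)) (σ : G →* (W →L[ℂ] W))

/-- **Lemma 4.3.3 (finite groups), matrix-coefficient form**:
`|G|⁻¹ Σ_g ⟪v, π g u⟫ · conj ⟪y, π g x⟫ = (dim V)⁻¹ ⟪x, u⟫ ⟪v, y⟫` for an irreducible unitary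
representation `π` of the finite group `G` on `V`. -/
theorem schur_orthogonality_finite [Nontrivial V] (hu : IsUnitary π) (hirr : IsIrreducible π)
    (u v x y : V) :
    (Fintype.card G : ℂ)⁻¹ * ∑ g, ⟪v, π g u⟫_ℂ * conj ⟪y, π g x⟫_ℂ =
      (Module.finrank ℂ V : ℂ)⁻¹ * (⟪x, u⟫_ℂ * ⟪v, y⟫_ℂ) := by
  rw [← integral_uniformOn_univ_complex]
  exact schur_orthogonality π (uniformOn (Set.univ : Set G)) continuous_of_discreteTopology hu hirr
    u v x y

/-- `|G|⁻¹ Σ_g |χ_π(g)|² = 1` for an irreducible unitary `π` of a finite group. -/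
theorem sum_character_mul_conj_finite [Nontrivial V] (hu : IsUnitary π) (hirr : IsIrreducible π) :
    (Fintype.card G : ℂ)⁻¹ * ∑ g, character π g * conj (character π g) = 1 := by
  rw [← integral_uniformOn_univ_complex]
  exact integral_character_mul_conj π (uniformOn (Set.univ : Set G))
    continuous_of_discreteTopology hu hirr

/-- The «otherwise 0» case for a finite group: matrix coefficients of `π` and `σ` are orthogonal
when no non-zero intertwiner exists. -/
theorem sum_inner_mul_conj_eq_zero_finite (hσu : IsUnitary σ)
    (hno : ∀ T : W →L[ℂ] V, (∀ g, π g ∘L T = T ∘L σ g) → T = 0) (u v : V) (x y : W) :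
    ∑ g, ⟪v, π g u⟫_ℂ * conj ⟪y, σ g x⟫_ℂ = 0 := by
  have h := integral_inner_mul_conj_eq_zero π σ (uniformOn (Set.univ : Set G))
    continuous_of_discreteTopology continuous_of_discreteTopology hσu hno u v x y
  rw [integral_uniformOn_univ_complex] at h
  have hc : (Fintype.card G : ℂ)⁻¹ ≠ 0 := by
    exact inv_ne_zero (by exact_mod_cast Fintype.card_ne_zero)
  exact (mul_eq_zero.mp h).resolve_left hc

end Summit.Ventures.HodgeRepro2.T5SchurFinite
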